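import Summits.CriticalPhenomena.CardyFormulaZ2.Theorems.CardyIKTransportIKLinearTransportStubCoalescingRowKernelIdentity
import Summits.CriticalPhenomena.CardyFormulaZ2.Theorems.CardyIKTransportIKLinearTransportStubCoalescingRowKernelTail

/-!
# Stub `stub_CoalescingRowKernel` (A_dyn') — part R: THE VERSION IS FIXED — certified coalescence one row
# after a cut row, and the REDUCTION of (A_dyn') to the cut-Markov property and locality

Support file (`--supports stmt-CriticalPhenomena-5076`, registered sub-goal
`coalescingRowKernel_of_cutMarkov`). With the levels `crkU`, the row kernel `crkG S i k` (`…Identity.lean`)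
and the CERTIFIED-COALESCENCE EVENTS `crkCoal i y m` := "some row among `y-m-1, …, y-1` is a cut row of the
environment" (read from the environment alone, measurable, shift-covariant), the registered signature of
`stub_CoalescingRowKernel` follows — sorry-free below — from

  (K)   `∀ S i, (i ∈ S ↔ i+1 ∉ S) → StripDiagramExchange S i → ∃ k, CutMarkovKernel S i k`, and
  (Loc) the `2r`-local approximants of the depth-`r` sweeps of `rowDyn i crkU (crkG S i k)` under `νmix S ⊗ β`
        (the `local_approx` clause verbatim, for every such `k`),

the tail being PROVED (`isCut_tail`, `…Tail.lean`: finite energy) and SOUNDNESS being a sure identity: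
`crk_coal_sound` — if `c` is a cut row of the environment `p`, the row maps at the rows `y' > c` read the
current configuration only on the middle rows `c+1 ≤ · < y'` (field `reads` of `CutMarkovKernel`, shift
covariance of `IsCut`, `pastMid ∘ vshift` bookkeeping), so by induction along the sweep
(`crk_sweep_agree`) any two starts agree on the middle rows `c+1 ≤ · ≤ y` once the sweep started at or
below `c+1`: garbage starts are absorbed one row after the first cut row, with no probability to pay.
This replaces the synchronising-row / 3⁄7 architecture of the wave-1 audit (no transfer-matrix comparison,
no large deviations: the cut rows are events of the pinned statistic, whose density is controlled by
finite energy).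

What then remains of (A_dyn'): (K) — the conditional-independence ("cut-Markov") property of the
diagram-conditioned middle column across a cut row, an exact structural statement (a priori structure of
`νmix` given the environment + rerouting of strip paths + conditional-independence plumbing) — and (Loc),
which follows from the two-sided version of the same factorisation (between two certified cut rows the
conditional row law is a function of the strip data in between), the agreement of the global and the
window strip diagrams between blocking rows, and `isCut_tail`-type finite-energy bounds.
-/

noncomputable section

namespace Summit.CriticalPhenomena.CardyFormulaZ2.Theorems.IKLinearTransport.PinnedDiagramExchange

open scoped Classical MeasureTheory ENNReal symmDiff
open Set MeasureTheory
open Literature.Probability.Percolation Literature.Probability.LatticeModels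


/-! ## The certified-coalescence events: a cut row at distance at most `m + 1` below -/

/-- CERTIFIED COALESCENCE: some row among `y-m-1, …, y-1` is a cut row of the environment. [folklore] -/
def crkCoal (i y : ℤ) (m : ℕ) : Set ((Obs × Set (Site 2 × Site 2)) × Rnd) :=
  {pu | ∃ c : ℤ, y - m - 1 ≤ c ∧ c ≤ y - 1 ∧ IsCut i c pu.1}

/-- The coalescence events are measurable. [folklore] -/
theorem measurableSet_crkCoal (i y : ℤ) (m : ℕ) : MeasurableSet (crkCoal i y m) := by
  have : crkCoal i y m = ⋃ c ∈ Finset.Icc (y - m - 1) (y - 1), {pu | IsCut i c pu.1} := by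
    ext pu; simp [crkCoal, and_assoc]
  rw [this]
  exact Finset.measurableSet_biUnion _ fun c _ => measurableSet_setOf.2 ((measurable_isCut i c).comp measurable_fst)

/-- Vertical covariance of the coalescence events. [folklore] -/
theorem crkCoal_cov (i y : ℤ) (m : ℕ) (kk : ℤ) (x : Obs) (u : Rnd) :
    (pinnedStat i (vshift kk x), ushift kk u) ∈ crkCoal i y m ↔ (pinnedStat i x, u) ∈ crkCoal i (y - kk) m := by
  simp only [crkCoal, mem_setOf_eq, pinnedStat_vshift', isCut_pshift]
  constructor
  · rintro ⟨c, h1, h2, h3⟩; exact ⟨c - kk, by omega, by omega, h3⟩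
  · rintro ⟨c, h1, h2, h3⟩; exact ⟨c + kk, by omega, by omega, by rwa [show c + kk - kk = c by ring]⟩

/-- The complement of the coalescence event is a cylinder over the configurations with no cut row in the
window. [folklore] -/
theorem crkCoal_compl_eq (i y : ℤ) (m : ℕ) :
    {xu : Obs × Rnd | (pinnedStat i xu.1, xu.2) ∉ crkCoal i y m} =
      {x : Obs | ∀ c' : ℤ, y - m - 1 ≤ c' → c' ≤ y - 1 → ¬ IsCut i c' (pinnedStat i x)} ×ˢ (univ : Set Rnd) := by
  ext xu
  simp only [crkCoal, mem_setOf_eq, not_exists, not_and, mem_prod, mem_univ, and_true]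

/-! ## Sweeps, one row at a time -/

/-- The row counter of the sweep. [folklore] -/
theorem crk_sweep_fst (Φ : ℤ → Obs × Set (Site 2 × Site 2) → Rnd → Obs → Obs) (a : ℤ)
    (p : Obs × Set (Site 2 × Site 2)) (u : Rnd) (z : Obs) :
    ∀ n : ℕ, ((fun q : ℤ × Obs => (q.1 + 1, Φ q.1 p u q.2))^[n] (a, z)).1 = a + n
  | 0 => by simp
  | n + 1 => by
    rw [Function.iterate_succ_apply', crk_sweep_fst Φ a p u z n]; push_cast; ring

/-- One more row of the sweep. [folklore] -/
theorem crk_rowSweep_succ (Φ : ℤ → Obs × Set (Site 2 × Site 2) → Rnd → Obs → Obs) (n : ℕ) (a : ℤ)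
    (p : Obs × Set (Site 2 × Site 2)) (u : Rnd) (z : Obs) :
    rowSweep Φ (n + 1) a p u z = Φ (a + n) p u (rowSweep Φ n a p u z) := by
  simp only [rowSweep]
  rw [Function.iterate_succ_apply', crk_sweep_fst Φ a p u z n]


/-! ## Soundness: one row after a cut row every start has coalesced -/

section Sound

variable (S : Set ℤ) (i : ℤ) (k : (Obs × Set (Site 2 × Site 2)) × Obs → Bool × Bool × Bool → ℝ)

/-- The row map of the reduction, unfolded: overwrite row `y` by the sampled row. [folklore] -/
theorem crk_rowDyn_eq (y : ℤ) (p : Obs × Set (Site 2 × Site 2)) (u : Rnd) (z : Obs) :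
    rowDyn i crkU (crkG S i k) y p u z = setMid i y z (toProp (crkQ k
      ((pshift (-y) p, pastMid i 0 (vshift (-y) z)), crkU ![i + 1, 0] (ushift (-y) u)))) := by
  rw [rowDyn, rowBits_crkG]

/-- The sampled row reads the statistic only through the kernel. [folklore] -/
theorem crkQ_congr {t t' : (Obs × Set (Site 2 × Site 2)) × Obs} (h : k t = k t') (r : ℝ) :
    crkQ k (t, r) = crkQ k (t', r) := by
  simp only [crkQ, crkWeights, h]

/-- Agreement of the middle data of two configurations on the rows `lo ≤ · < hi`. [folklore] -/
def MidAgree (i lo hi : ℤ) (z z' : Obs) : Prop :=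
  ∀ w : Site 2, lo ≤ w 1 → w 1 < hi →
    (w 0 = i + 1 → (w ∈ z.1 ↔ w ∈ z'.1)) ∧ ((w 0 = i ∨ w 0 = i + 1) → (w ∈ z.2 ↔ w ∈ z'.2))

/-- THE COALESCENCE STEP: for a cut-Markov kernel, if `c` is a cut row of the environment, two
configurations agreeing on the middle rows `c+1 ≤ · < y'` (with `c + 1 ≤ y' `, or vacuously) receive the
SAME new row `y'`. [folklore] -/
theorem crk_step_agree (hk : CutMarkovKernel S i k) (c y' : ℤ) (hcy : c + 1 ≤ y') (p : Obs × Set (Site 2 × Site 2))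
    (hcut : IsCut i c p) (u : Rnd) (A A' : Obs) (hA : MidAgree i (c + 1) y' A A') :
    MidAgree i (c + 1) (y' + 1) (rowDyn i crkU (crkG S i k) y' p u A) (rowDyn i crkU (crkG S i k) y' p u A') := by
  -- the two kernels read the same data
  have hker : k (pshift (-y') p, pastMid i 0 (vshift (-y') A)) = k (pshift (-y') p, pastMid i 0 (vshift (-y') A')) := by
    refine hk.reads (pshift (-y') p) _ _ (c - y') (by omega) ?_ fun w hw => ?_
    · rw [isCut_pshift, show c - y' - -y' = c by ring]; exact hcut
    · have e := ps2_sub_vec_apply w (-y')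
      have hA' := hA (w - ![0, -y']) (by rw [e.2]; omega)
      simp only [pastMid, vshift, mem_setOf_eq, Set.mem_preimage]
      constructor
      · constructor
        · rintro ⟨h1, h2, h3⟩; exact ⟨((hA' (by rw [e.2]; omega)).1 (by rw [e.1]; exact h2)).1 h1, h2, h3⟩
        · rintro ⟨h1, h2, h3⟩; exact ⟨((hA' (by rw [e.2]; omega)).1 (by rw [e.1]; exact h2)).2 h1, h2, h3⟩
      · constructor
        · rintro ⟨h1, h2, h3⟩; exact ⟨((hA' (by rw [e.2]; omega)).2 (by rw [e.1]; exact h2)).1 h1, h2, h3⟩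
        · rintro ⟨h1, h2, h3⟩; exact ⟨((hA' (by rw [e.2]; omega)).2 (by rw [e.1]; exact h2)).2 h1, h2, h3⟩
  have hQ := crkQ_congr k hker (crkU ![i + 1, 0] (ushift (-y') u))
  rw [crk_rowDyn_eq, crk_rowDyn_eq, ← hQ]
  set B := toProp (crkQ k ((pshift (-y') p, pastMid i 0 (vshift (-y') A)), crkU ![i + 1, 0] (ushift (-y') u)))
  intro w hw1 hw2
  by_cases hwy : w 1 = y'
  · -- the new row
    refine ⟨fun hw0 => ?_, fun hw0 => ?_⟩
    · have : w = ![i + 1, y'] := by rw [ps2_eq_vec2 w, hw0, hwy]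
      subst this
      rw [(rowBits_setMid i y' A B).1, (rowBits_setMid i y' A' B).1]
    · rcases hw0 with hw0 | hw0
      · have : w = ![i, y'] := by rw [ps2_eq_vec2 w, hw0, hwy]
        subst this
        rw [(rowBits_setMid i y' A B).2.1, (rowBits_setMid i y' A' B).2.1]
      · have : w = ![i + 1, y'] := by rw [ps2_eq_vec2 w, hw0, hwy]
        subst this
        rw [(rowBits_setMid i y' A B).2.2, (rowBits_setMid i y' A' B).2.2]
  · -- an old row
    have hw2' : w 1 < y' := by omega
    have hne1 : w ≠ ![i + 1, y'] := fun h => hwy (by rw [h]; simp)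
    have hne2 : w ≠ ![i, y'] := fun h => hwy (by rw [h]; simp)
    refine ⟨fun hw0 => ?_, fun hw0 => ?_⟩
    · rw [(setMid_off i y' A B).1 w hne1, (setMid_off i y' A' B).1 w hne1]
      exact (hA w hw1 hw2').1 hw0
    · rw [(setMid_off i y' A B).2 w hne2 hne1, (setMid_off i y' A' B).2 w hne2 hne1]
      exact (hA w hw1 hw2').2 hw0

/-- The sweeps from two starts agree above a cut row of the environment, as far as they have gone. [folklore] -/
theorem crk_sweep_agree (hk : CutMarkovKernel S i k) (c a : ℤ) (hca : a ≤ c + 1) (p : Obs × Set (Site 2 × Site 2))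
    (hcut : IsCut i c p) (u : Rnd) (z z' : Obs) : ∀ n : ℕ,
    MidAgree i (c + 1) (a + n) (rowSweep (rowDyn i crkU (crkG S i k)) n a p u z)
      (rowSweep (rowDyn i crkU (crkG S i k)) n a p u z')
  | 0 => fun w hw1 hw2 => by push_cast at hw2; omega
  | n + 1 => by
    rw [crk_rowSweep_succ, crk_rowSweep_succ, show a + ((n + 1 : ℕ) : ℤ) = (a + n) + 1 by push_cast; ring]
    by_cases hn : c + 1 ≤ a + n
    · exact crk_step_agree S i k hk c (a + n) hn p hcut u _ _ (crk_sweep_agree hk c a hca p hcut u z z' n)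
    · -- the new row is still at or below the cut: nothing to compare yet
      intro w hw1 hw2
      omega

/-- SOUNDNESS OF THE CERTIFIED COALESCENCE (field `coal_sound`): on `crkCoal i y m` the depth-`(m+1)` sweep
ending at row `y` produces the same row-`y` middle bits from every start. [folklore] -/
theorem crk_coal_sound (hk : CutMarkovKernel S i k) (y : ℤ) (m : ℕ) (p : Obs × Set (Site 2 × Site 2)) (u : Rnd)
    (hpu : (p, u) ∈ crkCoal i y m) (z : Obs) :
    (![i + 1, y] ∈ (rowSweep (rowDyn i crkU (crkG S i k)) (m + 1) (y - m) p u z).1 ↔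
      ![i + 1, y] ∈ (rowSweep (rowDyn i crkU (crkG S i k)) (m + 1) (y - m) p u p.1).1) ∧
    (![i, y] ∈ (rowSweep (rowDyn i crkU (crkG S i k)) (m + 1) (y - m) p u z).2 ↔
      ![i, y] ∈ (rowSweep (rowDyn i crkU (crkG S i k)) (m + 1) (y - m) p u p.1).2) ∧
    (![i + 1, y] ∈ (rowSweep (rowDyn i crkU (crkG S i k)) (m + 1) (y - m) p u z).2 ↔
      ![i + 1, y] ∈ (rowSweep (rowDyn i crkU (crkG S i k)) (m + 1) (y - m) p u p.1).2) := by
  obtain ⟨c, hc1, hc2, hcut⟩ := hpu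
  have h := crk_sweep_agree S i k hk c (y - m) (by omega) p hcut u z p.1 (m + 1)
  have hrow : y - m + ((m + 1 : ℕ) : ℤ) = y + 1 := by push_cast; ring
  rw [hrow] at h
  refine ⟨(h ![i + 1, y] (by simp; omega) (by simp)).1 (by simp), (h ![i, y] (by simp; omega) (by simp)).2 (by simp),
    (h ![i + 1, y] (by simp; omega) (by simp)).2 (by simp)⟩

end Sound


/-! ## The reduction -/

/-- Monotonicity of the exponential bounds in the constants. [folklore] -/
theorem crk_expBound_mono {C C' c c' : ℝ} (hC : C' ≤ C) (hC0 : 0 ≤ C) (hc : c ≤ c') (t : ℝ) (ht : 0 ≤ t) :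
    ENNReal.ofReal (C' * Real.exp (-c' * t)) ≤ ENNReal.ofReal (C * Real.exp (-c * t)) := by
  refine ENNReal.ofReal_le_ofReal ?_
  rcases le_or_gt 0 C' with hC' | hC'
  · calc C' * Real.exp (-c' * t) ≤ C' * Real.exp (-c * t) :=
          mul_le_mul_of_nonneg_left (Real.exp_le_exp.2 (by nlinarith)) hC'
      _ ≤ C * Real.exp (-c * t) := mul_le_mul_of_nonneg_right hC (Real.exp_pos _).le
  · calc C' * Real.exp (-c' * t) ≤ 0 := mul_nonpos_of_nonpos_of_nonneg hC'.le (Real.exp_pos _).le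
      _ ≤ C * Real.exp (-c * t) := mul_nonneg hC0 (Real.exp_pos _).le

/-- REDUCTION OF `stub_CoalescingRowKernel` (A_dyn') TO THE CUT-MARKOV PROPERTY AND THE LOCALITY OF THE
RESULTING DYNAMICS (registered sub-goal). Given, for every admissible `(S, i)`, a cut-Markov version `k` of
the conditional row law (`CutMarkovKernel S i k`: a measurable probability-vector-valued version of the law
of the middle row `0` of `νmix (S ∆ {i,i+1})` given the row statistic which reads the past only above any
cut row of the environment) and the `2r`-local approximants of the depth-`r` sweeps of the heat-bath
dynamics `rowDyn i crkU (crkG S i k)` built from it, the registered signature of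
`stub_CoalescingRowKernel` holds: the levels are the i.i.d. uniform levels `crkU`, the row kernel is `crkG`
(row `0` by the quantile of `k` with residual level, the rows above by the tail kernel; kernel identity
`crk_kernel_identity`), the certified-coalescence events are "a cut row among the `m+1` rows below"
(`crkCoal`: sound by `crk_coal_sound` — one row after a cut row EVERY start has coalesced, no probability
to pay —, exponentially likely by `isCut_tail`, covariant, measurable). [folklore] -/
theorem coalescingRowKernel_of_cutMarkov :
    (∀ (S : Set ℤ) (i : ℤ), (i ∈ S ↔ i + 1 ∉ S) → StripDiagramExchange S i →
      ∃ k : (Obs × Set (Site 2 × Site 2)) × Obs → Bool × Bool × Bool → ℝ, CutMarkovKernel S i k) →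
    (∃ C c : ℝ, 0 < c ∧ ∀ (S : Set ℤ) (i : ℤ) (k : (Obs × Set (Site 2 × Site 2)) × Obs → Bool × Bool × Bool → ℝ),
      (i ∈ S ↔ i + 1 ∉ S) → StripDiagramExchange S i → CutMarkovKernel S i k →
      ∀ (v : Site 2) (r : ℕ), ∃ Gfin : Obs → Rnd → Obs,
        (∀ (x x' : Obs) (u u' : Rnd),
          (∀ w ∈ ballInf v (2 * r), (w ∈ x.1 ↔ w ∈ x'.1) ∧ (w ∈ x.2 ↔ w ∈ x'.2) ∧
            ∀ k : ℕ, ((w, k) ∈ u ↔ (w, k) ∈ u')) →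
          ∀ w ∈ ballInf v r, (w ∈ (Gfin x u).1 ↔ w ∈ (Gfin x' u').1) ∧ (w ∈ (Gfin x u).2 ↔ w ∈ (Gfin x' u').2)) ∧
        ((νmix S).prod β) {xu | ∃ w ∈ ballInf v r,
          (w 0 = i + 1 ∧ ¬ (w ∈ (rowSweep (rowDyn i crkU (crkG S i k)) (r + 1) (w 1 - r) (pinnedStat i xu.1) xu.2
              (eraseMid i xu.1)).1 ↔ w ∈ (Gfin xu.1 xu.2).1)) ∨
          ((w 0 = i ∨ w 0 = i + 1) ∧ ¬ (w ∈ (rowSweep (rowDyn i crkU (crkG S i k)) (r + 1) (w 1 - r) (pinnedStat i xu.1)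
              xu.2 (eraseMid i xu.1)).2 ↔ w ∈ (Gfin xu.1 xu.2).2))} ≤ ENNReal.ofReal (C * Real.exp (-c * r))) →
    ∃ C c : ℝ, 0 < c ∧ ∀ (S : Set ℤ) (i : ℤ), (i ∈ S ↔ i + 1 ∉ S) → StripDiagramExchange S i →
      ∃ (U : Site 2 → Rnd → ℝ) (G : ((Obs × Set (Site 2 × Site 2)) × Obs) × ℝ → Obs)
        (Coal : ℤ → ℕ → Set ((Obs × Set (Site 2 × Site 2)) × Rnd)),
        (∀ v, Measurable (U v)) ∧
        (∀ v (u u' : Rnd), (∀ k : ℕ, ((v, k) ∈ u ↔ (v, k) ∈ u')) → U v u = U v u') ∧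
        (∀ v (m : ℤ) (u : Rnd), U v (ushift m u) = U (v - ![0, m]) u) ∧
        Measurable G ∧
        ((νmix (S ∆ {i, i + 1})).prod β).map
            (fun xu => (rowStat i xu.1, G (rowStat i xu.1, U ![i + 1, 0] xu.2))) =
          (νmix (S ∆ {i, i + 1})).map (fun x => (rowStat i x, x)) ∧
        (∀ y m, MeasurableSet (Coal y m)) ∧
        (∀ (y : ℤ) (m : ℕ) (p : Obs × Set (Site 2 × Site 2)) (u : Rnd), (p, u) ∈ Coal y m → ∀ z : Obs,
          (![i + 1, y] ∈ (rowSweep (rowDyn i U G) (m + 1) (y - m) p u z).1 ↔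
            ![i + 1, y] ∈ (rowSweep (rowDyn i U G) (m + 1) (y - m) p u p.1).1) ∧
          (![i, y] ∈ (rowSweep (rowDyn i U G) (m + 1) (y - m) p u z).2 ↔
            ![i, y] ∈ (rowSweep (rowDyn i U G) (m + 1) (y - m) p u p.1).2) ∧
          (![i + 1, y] ∈ (rowSweep (rowDyn i U G) (m + 1) (y - m) p u z).2 ↔
            ![i + 1, y] ∈ (rowSweep (rowDyn i U G) (m + 1) (y - m) p u p.1).2)) ∧
        (∀ (y : ℤ) (m : ℕ), ((νmix S).prod β) {xu | (pinnedStat i xu.1, xu.2) ∉ Coal y m} ≤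
          ENNReal.ofReal (C * Real.exp (-c * m))) ∧
        (∀ (y : ℤ) (m : ℕ) (k : ℤ) (x : Obs) (u : Rnd),
          (pinnedStat i (vshift k x), ushift k u) ∈ Coal y m ↔ (pinnedStat i x, u) ∈ Coal (y - k) m) ∧
        (∀ (v : Site 2) (r : ℕ), ∃ Gfin : Obs → Rnd → Obs,
          (∀ (x x' : Obs) (u u' : Rnd),
            (∀ w ∈ ballInf v (2 * r), (w ∈ x.1 ↔ w ∈ x'.1) ∧ (w ∈ x.2 ↔ w ∈ x'.2) ∧
              ∀ k : ℕ, ((w, k) ∈ u ↔ (w, k) ∈ u')) →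
            ∀ w ∈ ballInf v r, (w ∈ (Gfin x u).1 ↔ w ∈ (Gfin x' u').1) ∧ (w ∈ (Gfin x u).2 ↔ w ∈ (Gfin x' u').2)) ∧
          ((νmix S).prod β) {xu | ∃ w ∈ ballInf v r,
            (w 0 = i + 1 ∧ ¬ (w ∈ (rowSweep (rowDyn i U G) (r + 1) (w 1 - r) (pinnedStat i xu.1) xu.2
                (eraseMid i xu.1)).1 ↔ w ∈ (Gfin xu.1 xu.2).1)) ∨
            ((w 0 = i ∨ w 0 = i + 1) ∧ ¬ (w ∈ (rowSweep (rowDyn i U G) (r + 1) (w 1 - r) (pinnedStat i xu.1) xu.2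
                (eraseMid i xu.1)).2 ↔ w ∈ (Gfin xu.1 xu.2).2))} ≤ ENNReal.ofReal (C * Real.exp (-c * r))) := by
  intro hK hL
  obtain ⟨CL, cL, hcL, hL⟩ := hL
  obtain ⟨CT, cT, hcT, hCT0, hT⟩ := isCut_tail
  refine ⟨max CT (max CL 0), min cT cL, lt_min hcT hcL, fun S i hSi hX => ?_⟩
  obtain ⟨k, hk⟩ := hK S i hSi hX
  haveI : IsProbabilityMeasure β := crk_isProbabilityMeasure_beta
  refine ⟨crkU, crkG S i k, crkCoal i, crkU_spec.1, crkU_spec.2.1, crkU_spec.2.2.1, measurable_crkG S i k hk,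
    crk_kernel_identity S i k hk, measurableSet_crkCoal i, fun y m p u hpu z => crk_coal_sound S i k hk y m p u hpu z,
    fun y m => ?_, crkCoal_cov i, fun v r => ?_⟩
  · -- tail: the complement is a cylinder over "no cut row in the window"
    rw [crkCoal_compl_eq, Measure.prod_prod, measure_univ, mul_one]
    refine (hT S i y m).trans ?_
    exact crk_expBound_mono (le_max_left _ _) (hCT0.trans (le_max_left _ _)) (min_le_left _ _) m (Nat.cast_nonneg m)
  · -- locality: the hypothesis, with weaker constants
    obtain ⟨Gfin, hloc, hprob⟩ := hL S i k hSi hX hk v r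
    refine ⟨Gfin, hloc, hprob.trans ?_⟩
    refine (crk_expBound_mono (le_max_left CL 0) (le_max_right CL 0) le_rfl r (Nat.cast_nonneg r)).trans ?_
    exact crk_expBound_mono (le_max_right _ _) (hCT0.trans (le_max_left _ _)) (min_le_right _ _) r (Nat.cast_nonneg r)

end Summit.CriticalPhenomena.CardyFormulaZ2.Theorems.IKLinearTransport.PinnedDiagramExchange
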